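import Summits.Ventures.PercRepro2.CaseOneStarCertT1
import Summits.Ventures.PercRepro2.CaseOneGadgetUWA1BBlockI0
import Summits.Ventures.PercRepro2.CaseOneGadgetUWA1BBlockI1
import Summits.Ventures.PercRepro2.CaseOneGadgetUWA1BBlockI2
import Summits.Ventures.PercRepro2.CaseOneGadgetUWA1BBlockI3
import Summits.Ventures.PercRepro2.CaseOneGadgetUWA1BBlockI4
import Summits.Ventures.PercRepro2.CaseOneGadgetUWA1BBlockI5
import Summits.Ventures.PercRepro2.CaseOneGadgetUWA1BBlockI6
import Summits.Ventures.PercRepro2.CaseOneGadgetUWA1BBlockI7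
import Summits.Ventures.PercRepro2.CaseOneGadgetUWA1BBlockI8
import Summits.Ventures.PercRepro2.CaseOneGadgetUWA1BBlockI9
import Summits.Ventures.PercRepro2.CaseOneGadgetUWA1BBlockI10
import Summits.Ventures.PercRepro2.CaseOneGadgetUWA1BBlockI11
import Summits.Ventures.PercRepro2.CaseOneGadgetUWA1BBlockI12
import Summits.Ventures.PercRepro2.CaseOneGadgetUWA1BBlockI13
import Summits.Ventures.PercRepro2.CaseOneGadgetUWA1BBlockI14
import Summits.Ventures.PercRepro2.CaseOneStarFactsB

/-!
# The gadget `u ~ {w, a₁, b}`, `w ~ {u, a₂, o}` (uwa1b): the cell certificates of `iAB5` (part 34a)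
(blind cell PercRepro2, p1 g34; the fourth gadget anchor of the six-form calculus — all six forms of the uwa1b gadget
as plain SFacts-cone certificate chains, generated by mining/p1/g34/uwa1b/genu.py = p1 g33's gent_uwa1.py / g25's
geno.py re-targeted; P1-G33 §6–§6″, P1-G34)

Each `eBABI ijk kl` is a nonnegative combination of `(pairwise atom) × (cell)` and cubic cell monomials — or, for the degree-4 ones, `M × eBABI ijk kl` (`M = Σ cᵢ` the total cell mass) is a nonnegative combination of `(atom) × (cell) × (cell)` and quartic cell monomials, then `SFacts.nonneg_of_sum_mul` (`CaseOneStarCertT1`) — exact LP certificates (kit j319447, every certificate re-verified exactly; data/p1/g33/gcerts_i_uwa1b.json, form `i`), here as exact `linear_combination`s over `SFacts` (the rational coefficients cleared by their common denominator). -/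

namespace Summit.Ventures.PercRepro2

namespace CaseOne

section CertABI34a
variable {R : Type*} [Field R] [LinearOrder R] [IsStrictOrderedRing R]

set_option maxHeartbeats 0 in
/-- `eBABI23211 ≥ 0`: the combination is identically zero (`ring`). -/
lemma eBABI23211_nonneg (m : SCells R) (_hf : SFactsB m) : 0 ≤ eBABI23211 m := by
  have h : eBABI23211 m = 0 := by
    unfold eBABI23211 cBABI00111 cBABI00211 cBABI01011 cBABI01111 cBABI01211 cBABI02011 cBABI02111 cBABI02211 cBABI03111 cBABI03211 cBABI10011 cBABI10111 cBABI10211 cBABI11011 cBABI11111 cBABI11211 cBABI12011 cBABI12111 cBABI12211 cBABI13011 cBABI13111 cBABI13211 cBABI20011 cBABI20111 cBABI20211 cBABI21011 cBABI21111 cBABI21211 cBABI22011 cBABI22111 cBABI22211 cBABI23011 cBABI23111 cBABI23211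
    ring
  linarith [h]

set_option maxHeartbeats 0 in
/-- `eBABI23212 ≥ 0`: the combination is identically zero (`ring`). -/
lemma eBABI23212_nonneg (m : SCells R) (_hf : SFactsB m) : 0 ≤ eBABI23212 m := by
  have h : eBABI23212 m = 0 := by
    unfold eBABI23212 cBABI00112 cBABI00212 cBABI01012 cBABI01112 cBABI01212 cBABI02012 cBABI02112 cBABI02212 cBABI03112 cBABI03212 cBABI10012 cBABI10112 cBABI10212 cBABI11012 cBABI11112 cBABI11212 cBABI12012 cBABI12112 cBABI12212 cBABI13012 cBABI13112 cBABI13212 cBABI20012 cBABI20112 cBABI20212 cBABI21012 cBABI21112 cBABI21212 cBABI22012 cBABI22112 cBABI22212 cBABI23012 cBABI23112 cBABI23212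
    ring
  linarith [h]

end CertABI34a

end CaseOne

end Summit.Ventures.PercRepro2
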